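import Literature.NumberTheory.Automorphic.PlaneLatticesCompanionSelfDualCount        -- ★ (β2′-ii) the level-0 count and its currency (`glInt`, `formCongr`, Hermite matrices)
import Literature.NumberTheory.Automorphic.FixedCosetsLevelShift                    -- ★ B-p10 the level token (entries of `g⁻¹γg − 1`)
import HarnessLib

/-!
# The level-`j` condition on a companion-stable Hermite plane lattice, in coordinates; anti-fixed classes in a shifted ideal

Topic `NumberTheory/Automorphic`; namespace `Literature.NumberTheory.Automorphic`.  THEOREMS ONLY (no definition, no instance, no notation, no named fact,
no `sorry`).  Cell `pub/hodgecm-mathlib`, crux H413, road «S3-tree» brick **T6-2** (H-side germ table, type-(2) rows), ORGANS for the level-`j` count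
★-twin `PlaneLatticesCompanionSelfDualLevelCount` (END∕T6 holder F0P3a-p03 (g14); architect A-59 (2)).  HC_CM is proved only modulo the cell's 2 remaining named
inputs (hLiu418, h413) until rung 0 closes; this file is unconditional and elementary.

* §1 `natCard_antifixed_mem_pow_eq` — `#{x̄ ∈ 𝒪 ⧸ 𝔪^k : σ̄x̄ = −x̄, x ∈ 𝔪^m} = q^{k−m}` (`m ≤ k`): multiplication by `ϖ^m` (`σϖ = ϖ`) from the anti-fixed classes of
  `𝒪 ⧸ 𝔪^{k−m}` (★ `natCard_antifixed_quotient_pow`).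
* §2 `forall_valuation_sub_one_le_iff_of_hermite_companion` — for `T = T(k, y, −k−e)`, `y′ = ϖ^{k+e} y ∈ 𝒪`, `C = C(t, d)` with `|t² − 4d| = |ϖ|^{2N+1}` and
  `|t − 2| ≤ |ϖ^j|`: all entries of `T⁻¹CT − 1` have valuation `≤ |ϖ^j|` iff `j ≤ 2k + e`, `2k + e + j ≤ 2N + 1` and `|2y′ + t| ≤ |ϖ|^{k+e+⌈(j−e)∕2⌉}` — the entries
  are `−y′−1`, `−ϖ^{−(2k+e)}(y′² + ty′ + d)`, `ϖ^{2k+e}`, `y′ + t − 1` (★ `upperTriangular_inv_mul_companion_mul`), and `4(y′² + ty′ + d) = (2y′+t)² − (t² − 4d)` has the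
  valuation of the larger term (even vs. odd exponent, as in ★ `norm_condition_iff`).

## References
* [Flicker1998UnitaryFL] Y. Z. Flicker, *Elementary proof of the fundamental lemma for a unitary group*, Canad. J. Math. 50 (1998), §6 p. 97.
* [Serre1979] J.-P. Serre, *Local Fields*, GTM 67 (1979), Ch. V §2.
* [Serre1980Trees] J.-P. Serre, *Trees* (1980), Ch. II §1.1–1.2 (distance on the tree and the congruence level of a stabiliser).
-/

set_option autoImplicit false

noncomputable section

open scoped ValuativeRel Matrix MatrixGroups
open Matrix ValuativeRel Finset IsLocalRing

namespace Literature.NumberTheory.Automorphic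

variable {F : Type*} [Field F] [ValuativeRel F] {ϖ : F} (hϖ : IsUniformizingElement ϖ) (σ : F →+* F)
  [IsDiscreteValuationRing 𝒪[F]]
  (σO : 𝒪[F] →+* 𝒪[F]) (hσO' : ∀ x : 𝒪[F], ((σO x : 𝒪[F]) : F) = σ x) (hσσ : ∀ x, σO (σO x) = x) (hσϖ : σ ϖ = ϖ)

/-! ## §1 Anti-fixed classes in a shifted ideal: `#{x̄ ∈ 𝒪 ⧸ 𝔪^k : σ̄x̄ = −x̄, x ∈ 𝔪^m} = q^{k−m}` -/

include hϖ hσO' hσσ hσϖ in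
/-- **ANTI-FIXED CLASSES IN `𝔪^m ⧸ 𝔪^k`**: multiplication by `ϖ^m` (`σϖ = ϖ`) is a bijection from the anti-fixed classes of `𝒪 ⧸ 𝔪^{k−m}` onto the anti-fixed classes of
`𝒪 ⧸ 𝔪^k` lying in `𝔪^m`; hence the latter number `q^{k−m}` (★ `natCard_antifixed_quotient_pow`). [cite: Serre1979, Ch. V §2] -/
theorem natCard_antifixed_mem_pow_eq {q : ℕ} [Finite (ResidueField 𝒪[F])] (hq : Nat.card (ResidueField 𝒪[F]) = q ^ 2)
    {a₀ : 𝒪[F]} (ha₀ : IsUnit (σO a₀ - a₀)) {m k : ℕ} (hmk : m ≤ k) :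
    Nat.card {x : 𝒪[F] ⧸ maximalIdeal 𝒪[F] ^ k //
        Ideal.quotientMap (maximalIdeal 𝒪[F] ^ k) σO (LocalFields.UnramifiedQuadraticNorm.maximalIdeal_pow_le_comap σO hσσ k) x = -x ∧
          ∃ w : 𝒪[F], Ideal.Quotient.mk (maximalIdeal 𝒪[F] ^ k) w = x ∧ ϖ ^ (-(m : ℤ)) * (w : F) ∈ 𝒪[F]} = q ^ (k - m) := by
  classical
  have h0 := hϖ.ne_zero
  have hϖm : (ϖ : F) ^ m ∈ 𝒪[F] := by
    have := (zpow_uniformizer_mem_integer_iff hϖ (m : ℤ)).2 (by positivity); rwa [zpow_natCast] at this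
  rw [← LocalFields.UnramifiedQuadraticNorm.natCard_antifixed_quotient_pow σO hσσ ha₀ hq (k - m)]
  -- notation
  set Ik := maximalIdeal 𝒪[F] ^ k with hIk
  set Ij := maximalIdeal 𝒪[F] ^ (k - m) with hIj
  set σk := Ideal.quotientMap Ik σO (LocalFields.UnramifiedQuadraticNorm.maximalIdeal_pow_le_comap σO hσσ k) with hσk
  set σj := Ideal.quotientMap Ij σO (LocalFields.UnramifiedQuadraticNorm.maximalIdeal_pow_le_comap σO hσσ (k - m)) with hσj
  -- the shift `w ↦ ϖ^m w` on `𝒪`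
  set sh : 𝒪[F] → 𝒪[F] := fun w => ⟨ϖ ^ m * w, (𝒪[F]).mul_mem hϖm w.2⟩ with hsh
  have hshv : ∀ w : 𝒪[F], ((sh w : 𝒪[F]) : F) = ϖ ^ m * w := fun w => rfl
  have hσsh : ∀ w : 𝒪[F], σO (sh w) = sh (σO w) := fun w => by
    apply Subtype.ext
    rw [hσO', hshv, hshv, map_mul, map_pow, hσϖ, ← hσO' w]
  -- `mk`-equalities through `ϖ^{-n}(a − b) ∈ 𝒪`
  have hmkq : ∀ (n : ℕ) (a b : 𝒪[F]), Ideal.Quotient.mk (maximalIdeal 𝒪[F] ^ n) a = Ideal.Quotient.mk (maximalIdeal 𝒪[F] ^ n) b ↔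
      ϖ ^ (-(n : ℤ)) * ((a : F) - b) ∈ 𝒪[F] := fun n a b => (zpow_neg_mul_coe_sub_mem_iff_mk_eq_mk hϖ n a b).symm
  -- the key rescaling: `ϖ^{-k}(ϖ^m a − ϖ^m b) = ϖ^{-(k-m)}(a − b)`
  have hkm : (-(k : ℤ)) + (m : ℤ) = -((k - m : ℕ) : ℤ) := by push_cast [Nat.cast_sub hmk]; ring
  have hresc : ∀ a b : 𝒪[F], ϖ ^ (-(k : ℤ)) * (((sh a : 𝒪[F]) : F) - (sh b : 𝒪[F])) = ϖ ^ (-((k - m : ℕ) : ℤ)) * ((a : F) - b) := fun a b => by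
    rw [hshv, hshv, ← mul_sub, ← mul_assoc, ← zpow_natCast, ← zpow_add₀ h0, hkm]
  have hshift : ∀ a b : 𝒪[F], Ideal.Quotient.mk Ik (sh a) = Ideal.Quotient.mk Ik (sh b) ↔ Ideal.Quotient.mk Ij a = Ideal.Quotient.mk Ij b := fun a b => by
    rw [hIk, hIj, hmkq, hmkq, hresc]
  -- anti-fixedness transfers
  have hanti : ∀ w : 𝒪[F], σk (Ideal.Quotient.mk Ik (sh w)) = -Ideal.Quotient.mk Ik (sh w) ↔ σj (Ideal.Quotient.mk Ij w) = -Ideal.Quotient.mk Ij w := fun w => by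
    rw [hσk, hσj, Ideal.quotientMap_mk, Ideal.quotientMap_mk, hσsh, ← map_neg, ← map_neg]
    have : -sh w = sh (-w) := by apply Subtype.ext; rw [Subring.coe_neg, hshv, hshv, Subring.coe_neg, mul_neg]
    rw [this]
    exact hshift _ _
  -- lifts
  have hlift : ∀ x : 𝒪[F] ⧸ Ij, ∃ z : 𝒪[F], Ideal.Quotient.mk Ij z = x := fun x => Ideal.Quotient.mk_surjective x
  choose lift hlift using hlift
  symm
  refine Nat.card_congr (Equiv.ofBijective (fun x => ⟨Ideal.Quotient.mk Ik (sh (lift x.1)), ?_, sh (lift x.1), rfl, ?_⟩) ⟨?_, ?_⟩)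
  · rw [hanti, hlift]; exact x.2
  · rw [hshv, ← mul_assoc, ← zpow_natCast, ← zpow_add₀ h0, neg_add_cancel, zpow_zero, one_mul]; exact (lift x.1).2
  · rintro ⟨x, hx⟩ ⟨x', hx'⟩ h
    have h' := congrArg (fun y => (y.1 : 𝒪[F] ⧸ Ik)) h
    dsimp only at h'
    apply Subtype.ext
    show x = x'
    rw [← hlift x, ← hlift x']
    exact (hshift _ _).1 h'
  · rintro ⟨x, hx, w, rfl, hw⟩
    -- `w = ϖ^m · w₀`, `w₀ := ϖ^{-m} w ∈ 𝒪`
    have hw' : sh ⟨_, hw⟩ = w := by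
      apply Subtype.ext
      rw [hshv, ← mul_assoc, ← zpow_natCast, ← zpow_add₀ h0, add_neg_cancel, zpow_zero, one_mul]
    refine ⟨⟨Ideal.Quotient.mk Ij ⟨_, hw⟩, (hanti _).1 (by rw [hw']; exact hx)⟩, Subtype.ext ?_⟩
    show Ideal.Quotient.mk Ik (sh (lift (Ideal.Quotient.mk Ij ⟨_, hw⟩))) = Ideal.Quotient.mk Ik w
    calc Ideal.Quotient.mk Ik (sh (lift (Ideal.Quotient.mk Ij ⟨_, hw⟩))) = Ideal.Quotient.mk Ik (sh ⟨_, hw⟩) := (hshift _ _).2 (hlift _)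
      _ = Ideal.Quotient.mk Ik w := by rw [hw']


/-! ## §2 The level-`j` condition in Hermite coordinates -/

include hϖ in
/-- **THE LEVEL-`j` CONDITION IN HERMITE COORDINATES**: for `T = T(k, y, −k−e)` with `y′ = ϖ^{k+e}y ∈ 𝒪` and `γ = C(t,d)` deep (`|t − 2| ≤ |ϖ^j|`), all entries of
`T⁻¹ C T − 1` have valuation `≤ |ϖ^j|` iff `j ≤ 2k + e`, `2k + e + j ≤ 2N + 1` and `|2y′ + t| ≤ |ϖ|^{k + e + ⌈(j−e)∕2⌉}` (entries ★ `upperTriangular_inv_mul_companion_mul`;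
the norm entry by the odd∕even split of ★ `norm_condition_iff`). [cite: Flicker1998UnitaryFL, §6 p. 97] [cite: Serre1980Trees, Ch. II §1.1] -/
theorem forall_valuation_sub_one_le_iff_of_hermite_companion (h2 : valuation F 2 = 1) {t d : F} (ht : t ∈ 𝒪[F]) {N : ℕ}
    (hD : valuation F (t ^ 2 - 4 * d) = valuation F (ϖ ^ (2 * N + 1))) {k e : ℕ} (he : e ≤ 1) {y : F}
    (hy' : ϖ ^ (-(-(k : ℤ) - e)) * y ∈ 𝒪[F]) (γ g : GL (Fin 2) F) (hγ : (γ : Matrix (Fin 2) (Fin 2) F) = !![0, -d; 1, t])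
    (hg : (g : Matrix (Fin 2) (Fin 2) F) = !![ϖ ^ (k : ℤ), y; 0, ϖ ^ (-(k : ℤ) - e)]) {j : ℕ} (ht2 : valuation F (t - 2) ≤ valuation F (ϖ ^ j)) :
    (∀ i k', valuation F ((((g⁻¹ * γ * g : GL (Fin 2) F) : Matrix (Fin 2) (Fin 2) F) - 1) i k') ≤ valuation F (ϖ ^ j)) ↔
      j ≤ 2 * k + e ∧ 2 * k + e + j ≤ 2 * N + 1 ∧
        valuation F (2 * (ϖ ^ (-(-(k : ℤ) - e)) * y) + t) ≤ valuation F (ϖ ^ (((k + e + (j - e + 1) / 2 : ℕ)) : ℤ)) := by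
  have h0 := hϖ.ne_zero
  have h20 : (2 : F) ≠ 0 := fun h => by rw [h, map_zero] at h2; exact zero_ne_one h2
  set l : ℤ := -(k : ℤ) - e with hl
  set a : F := ϖ ^ (-l) * y with ha
  set s : F := 2 * a + t with hs
  have hcj : valuation F (ϖ ^ j) = valuation F (ϖ ^ (j : ℤ)) := by rw [zpow_natCast]
  -- the conjugate, entrywise
  have hm : ((g⁻¹ * γ * g : GL (Fin 2) F) : Matrix (Fin 2) (Fin 2) F) =
      !![-(y * (ϖ ^ l)⁻¹), -((ϖ ^ (k : ℤ))⁻¹ * (ϖ ^ l)⁻¹ * (y ^ 2 + t * y * ϖ ^ l + d * (ϖ ^ l) ^ 2)); ϖ ^ (k : ℤ) * (ϖ ^ l)⁻¹, y * (ϖ ^ l)⁻¹ + t] := by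
    rw [Units.val_mul, Units.val_mul, Matrix.coe_units_inv, hg, hγ, upperTriangular_inv_mul_companion_mul (zpow_ne_zero _ h0) (zpow_ne_zero l h0)]
  have hy1 : y * (ϖ ^ l)⁻¹ = a := by rw [ha, ← _root_.zpow_neg, mul_comm]
  have hkl : (ϖ : F) ^ (k : ℤ) * (ϖ ^ l)⁻¹ = ϖ ^ (((2 * k + e : ℕ)) : ℤ) := by
    rw [← _root_.zpow_neg, ← zpow_add₀ h0, hl]; congr 1; push_cast; ring
  have h12 : (ϖ ^ (k : ℤ))⁻¹ * (ϖ ^ l)⁻¹ * (y ^ 2 + t * y * ϖ ^ l + d * (ϖ ^ l) ^ 2) = ϖ ^ (-((2 * k + e : ℕ) : ℤ)) * (a ^ 2 + t * a + d) := by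
    have h2l : (ϖ ^ l) ^ 2 = ϖ ^ (2 * l) := by rw [← zpow_natCast, ← _root_.zpow_mul, mul_comm]; norm_num
    have hkl' : (ϖ ^ (k : ℤ))⁻¹ * (ϖ ^ l)⁻¹ = ϖ ^ (-((k : ℤ) + l)) := by rw [← _root_.zpow_neg, ← _root_.zpow_neg, ← zpow_add₀ h0, neg_add]
    rw [hkl', h2l, ha]
    exact (companion_rescale_identities h0 (k := k) (e := e) hl y t d 0 0 0).1
  rw [hy1, hkl, h12] at hm
  -- the four entries of `M − 1`
  set M : Matrix (Fin 2) (Fin 2) F := ((g⁻¹ * γ * g : GL (Fin 2) F) : Matrix (Fin 2) (Fin 2) F) with hM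
  have e00 : (M - 1) 0 0 = -(a + 1) := by rw [Matrix.sub_apply, hm, Matrix.one_apply_eq]; simp; ring
  have e01 : (M - 1) 0 1 = -(ϖ ^ (-((2 * k + e : ℕ) : ℤ)) * (a ^ 2 + t * a + d)) := by
    rw [Matrix.sub_apply, hm, Matrix.one_apply_ne (by decide)]; simp
  have e10 : (M - 1) 1 0 = ϖ ^ (((2 * k + e : ℕ)) : ℤ) := by rw [Matrix.sub_apply, hm, Matrix.one_apply_ne (by decide)]; simp
  have e11 : (M - 1) 1 1 = (a + 1) + (t - 2) := by rw [Matrix.sub_apply, hm, Matrix.one_apply_eq]; simp; ring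
  rw [Fin.forall_fin_two, Fin.forall_fin_two, Fin.forall_fin_two, e00, e01, e10, e11, Valuation.map_neg, Valuation.map_neg]
  -- (1,0): `j ≤ 2k + e`
  have c10 : valuation F (ϖ ^ (((2 * k + e : ℕ)) : ℤ)) ≤ valuation F (ϖ ^ j) ↔ j ≤ 2 * k + e := by
    rw [hcj, valuation_zpow_le_valuation_zpow_iff hϖ]; push_cast; omega
  -- (0,0) & (1,1): `|a + 1| ≤ |ϖ^j| ↔ |s| ≤ |ϖ^j|`
  have h2v : ∀ w : F, valuation F (2 * w) = valuation F w := fun w => by rw [map_mul, h2, one_mul]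
  have c11 : valuation F (a + 1 + (t - 2)) ≤ valuation F (ϖ ^ j) ↔ valuation F (a + 1) ≤ valuation F (ϖ ^ j) := by
    constructor
    · intro h
      have : a + 1 = (a + 1 + (t - 2)) - (t - 2) := by ring
      rw [this]; exact (Valuation.map_sub _ _ _).trans (max_le h ht2)
    · intro h; exact (Valuation.map_add _ _ _).trans (max_le h ht2)
  have c00 : valuation F (a + 1) ≤ valuation F (ϖ ^ j) ↔ valuation F s ≤ valuation F (ϖ ^ j) := by
    constructor
    · intro h
      have : s = 2 * (a + 1) + (t - 2) := by rw [hs]; ring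
      rw [this]; exact (Valuation.map_add _ _ _).trans (max_le (by rw [h2v]; exact h) ht2)
    · intro h
      have : a + 1 = 2⁻¹ * (s - (t - 2)) := by rw [hs]; field_simp; ring
      rw [this, map_mul, map_inv₀, h2, inv_one, one_mul]; exact (Valuation.map_sub _ _ _).trans (max_le h ht2)
  -- (0,1): the norm entry
  have hpos : ∀ z : ℤ, 0 < valuation F (ϖ ^ z) := fun z => (Valuation.pos_iff _).2 (zpow_ne_zero _ h0)
  have c01 : valuation F (ϖ ^ (-((2 * k + e : ℕ) : ℤ)) * (a ^ 2 + t * a + d)) ≤ valuation F (ϖ ^ j) ↔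
      valuation F (s ^ 2 - (t ^ 2 - 4 * d)) ≤ valuation F (ϖ ^ (((2 * k + e + j : ℕ)) : ℤ)) := by
    have h4 : valuation F (a ^ 2 + t * a + d) = valuation F (s ^ 2 - (t ^ 2 - 4 * d)) := by
      have : s ^ 2 - (t ^ 2 - 4 * d) = 2 * (2 * (a ^ 2 + t * a + d)) := by rw [hs]; ring
      rw [this, h2v, h2v]
    have hexp : (((2 * k + e : ℕ)) : ℤ) + (j : ℤ) = ((2 * k + e + j : ℕ) : ℤ) := by push_cast; ring
    rw [hcj, map_mul, _root_.zpow_neg, map_inv₀, inv_mul_le_iff₀ (hpos _), ← map_mul, ← zpow_add₀ h0, h4, hexp]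
  rw [c10, c11, c00, c01]
  -- valuation bookkeeping on `s`
  have hsO : s ∈ 𝒪[F] := (𝒪[F]).add_mem ((𝒪[F]).mul_mem ((Valuation.mem_integer_iff _ _).2 h2.le) hy') ht
  have hD' : valuation F (t ^ 2 - 4 * d) = valuation F (ϖ ^ (((2 * N + 1 : ℕ)) : ℤ)) := by rw [zpow_natCast]; exact hD
  by_cases hs0 : s = 0
  · rw [hs0, map_zero, zero_pow two_ne_zero, zero_sub, Valuation.map_neg, hD', valuation_zpow_le_valuation_zpow_iff hϖ]
    simp only [zero_le, true_and, and_true]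
    constructor
    · rintro ⟨h3, h1⟩; exact ⟨h1, by exact_mod_cast h3⟩
    · rintro ⟨h1, h3⟩; exact ⟨by exact_mod_cast h3, h1⟩
  · obtain ⟨m, hm'⟩ := exists_valuation_eq_valuation_zpow hϖ hs0
    have hm0 : 0 ≤ m := by
      have : valuation F s ≤ 1 := (Valuation.mem_integer_iff _ _).1 hsO
      rw [hm', show (1 : ValueGroupWithZero F) = valuation F (ϖ ^ (0 : ℤ)) by rw [zpow_zero, map_one],
        valuation_zpow_le_valuation_zpow_iff hϖ] at this
      exact this
    have hm2 : valuation F (s ^ 2) = valuation F (ϖ ^ (2 * m)) := by rw [map_pow, hm', ← map_pow, ← zpow_natCast, ← _root_.zpow_mul, mul_comm]; rfl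
    have hne : valuation F (s ^ 2) ≠ valuation F (t ^ 2 - 4 * d) := by
      rw [hm2, hD']
      intro h
      have h1 := (valuation_zpow_le_valuation_zpow_iff hϖ _ _).1 h.le
      have h2' := (valuation_zpow_le_valuation_zpow_iff hϖ _ _).1 h.ge
      omega
    have hmax : valuation F (s ^ 2 - (t ^ 2 - 4 * d)) = max (valuation F (s ^ 2)) (valuation F (t ^ 2 - 4 * d)) := by
      rw [sub_eq_add_neg, Valuation.map_add_of_distinct_val _ (by rwa [Valuation.map_neg]), Valuation.map_neg]
    rw [hmax, max_le_iff, hm2, hD', hm', hcj, valuation_zpow_le_valuation_zpow_iff hϖ, valuation_zpow_le_valuation_zpow_iff hϖ,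
      valuation_zpow_le_valuation_zpow_iff hϖ, valuation_zpow_le_valuation_zpow_iff hϖ]
    constructor
    · intro h
      obtain ⟨⟨-, hB, hC⟩, hD, -⟩ := h
      push_cast at hB hC ⊢
      exact ⟨hD, by omega, by omega⟩
    · intro h
      obtain ⟨hD, hC, hE⟩ := h
      push_cast at hC hE ⊢
      exact ⟨⟨by omega, by omega, by omega⟩, hD, by omega⟩


end Literature.NumberTheory.Automorphic

end
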